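import Summits.QuantumFields.BalabanUV.Beta.GAN24.ContactOneGaugeCellTable
import Summits.QuantumFields.BalabanUV.Beta.GAN24.ContactCellSplit

/-!
# `BalabanUV.Beta.GAN24.ContactCellReduction` — binder row G-an2-4 / (CONV-C), the row owner's CONTACT-TERM ROUTE (`gen18/CT3-MECHANISM.md` v1.1 §(c),
# `gen19/CT3-MECHANISM-v1.2.md` §A–§B), CT-3c analysis: leaf-02's ONE-GAUGE CELL WITH DRESSED PARTNERS REDUCED TO ITS PIECES — the two UNDRESSED three-envelope
# terms BOUNDED (leaf-02's `ContactOneGaugeCellBound.abs_tsum_weight_mul_mul_le`), the dressed partners' gauge parts LEFT AS EXPLICIT STAIRCASE PAIRINGS against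
# the tent forces (to be bounded by the owner's `StaircasePairing.abs_pairing_le_sum` ∕ leaf-03 g52's `StaircasePairingReadings.abs_pairingTip_le_of_geometric`).

NOT IN PRINT; OUR BOOKKEEPING (G-an2-4 formalisation swarm, leaf prover `b2b-balaban-gan24-formalise-leaf-01`, gen 58; CT-3c under «MINE» l.31499 ∕ 31626 ∕ 31667 ∕
31740; owner's GO `CT3-MECHANISM-v1.2.md` §A (l.31770), choice (b) l.31846 ∕ l.31868; names PROVISIONAL).  HONEST FRAMING (cell contract, verbatim): «discharging
`BetaPertH` makes Bałaban's UV stability UNCONDITIONAL — a real constructive-QFT result; it is NOT the continuum limit and NOT the Clay problem.»  HONEST DEPENDENCY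
(verbatim): «continuum YM on T⁴ ⇐ BetaPertH ∧ nine spine estimates (0/9 proved); BetaPertH ⇐ (D1) ∧ (D4) ∧ CAP+tail; G-an2-4 gates asym, D1 and NE2/3/4.»

WHAT (generic `d`; `E_c(u) = e^{−κ₀‖quo N u − c‖∞}`, `ENV3(c₀; c₁, c₃) = N^{d+1}·Zl(κ₀∕(4(d+1)))·e^{−(κ₀∕12)(‖c₁−c₀‖∞+‖c₃−c₀‖∞)}`; B6 `unitVec` = the cells' spelling):
* §1 `affine_dz` bookkeeping: `AffineAveraging.unitVec = B6BondElimination.unitVec` under the binders (leaf-02's `affine_unitVec_eq`), envelope ⇒ sup ∕ summable.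
* §2 **`abs_cellL_le_pieces`** (the LEFT-type cell: BOTH partners dressed — `T₁ = B₁ + dλ₁` in the TIP position about `c₁`, `T₃ = B₃ + dλ₃` in the MIDPOINT position
  about `c₃`; Maxwell operators `d*dT_i = 𝒬ᵀ_N φ_i` with tent envelopes `τ_i E_{c_i}`; gauge weight `|ψ| ≤ Eψ·E_{c₀}`):
  `|Σ'_z Σ_b T₃ b z·Σ'_u Σ_κ T₁ κ u·(½(ψ(u+e_κ) − ½(ψ z + ψ(z+e_b)))·(d*dδ_{(κ,u)})_b z)|`
  `≤ ½(d+1)·Eψ·e^{κ₀}·(EB₁·τ₃ + EB₃·τ₁)·ENV3(c₀; c₁, c₃)`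
  `+ ½·Σ_κ |Σ'_u 𝒬ᵀ_Nφ₃ κ u·ψ(u+e_κ)·(λ₁(u+e_κ) − λ₁ u)| + ½·Σ_b |Σ'_z 𝒬ᵀ_Nφ₁ b z·½(ψ z + ψ(z+e_b))·(λ₃(z+e_b) − λ₃ z)|`
  (`cell_eq'` + `ContactCellSplit.split_tip ∕ split_mid` + leaf-02's three-envelope bound with the tip ∕ midpoint weights; the two pairing sums in the
  AFFINE `unitVec` spelling of the owner's `StaircasePairing`).
* §3 **`abs_cellR_le_pieces`** (the RIGHT-type cell: the OUTER partner `T₃ = B₃` UNDRESSED about `c₃`, the inner `T₁ = B₁ + dλ₁` dressed about `c₁`):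
  the same with only the tip pairing.
(The TABLE cell has both partners undressed: leaf-02's `abs_cellIdx_le'` bounds it as it stands.)
[folklore] throughout: leaf-02's cells ∕ bounds and `ContactCellSplit` BY NAME; 0 `def`, 0 cited facts, 0 `def … : Prop`, 0 sorry.  NO new estimate; discharges NOTHING
of (hS, hSall) on (E); 0 wall binders; NEVER «G-an2-4 closed»; NOT D1, NOT BetaPertH, NOT continuum, NOT Clay.
-/

noncomputable section

open Finset
open scoped BigOperators
open Literature.MathematicalPhysics.QuantumFieldTheory
open Literature.MathematicalPhysics.QuantumFieldTheory.LatticeForm (quo)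
open Literature.MathematicalPhysics.QuantumFieldTheory.Balaban1983to89
open Literature.MathematicalPhysics.QuantumFieldTheory.Balaban1983to89.Beta
open B4ContourShift (supNorm supNorm_nonneg)
open ExpKernelCalculus (Zl Zl_nonneg)
open AffineAveraging (Form0 Form1 Site curv curvAdj)
open AffineReproduction (contourSumAdj)
open B6BondElimination (unitVec)
open KKTFluctuationKernel (delta1)
open Summit.QuantumFields.BalabanUV.Beta.GAN24.EnvelopeBlockSum (env_le_one summable_env)
open Summit.QuantumFields.BalabanUV.Beta.GAN24.ContactOneGaugeCellAlgebra (affine_unitVec_eq)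
open Summit.QuantumFields.BalabanUV.Beta.GAN24.ContactOneGaugeCellBound (tsum_env3_le abs_tsum_weight_mul_mul_le abs_tip_weight_le abs_mid_weight_le
  abs_le_of_env summable_of_env)
open Summit.QuantumFields.BalabanUV.Beta.GAN24.ContactOneGaugeCellTable (cell_eq')
open Summit.QuantumFields.BalabanUV.Beta.GAN24.ContactCellSplit (split_tip split_mid)

namespace Summit.QuantumFields.BalabanUV.Beta.GAN24.ContactCellReduction

variable {d : ℕ} {N : ℕ} {κ₀ : ℝ}

/-! ## §1 Bookkeeping -/

/-- [folklore] An envelope bound is a sup bound by a nonnegative constant times one (`E ≤ 1`), for 1-forms. -/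
theorem abs_le_of_env₁ (hκ : 0 ≤ κ₀) {T : Form1 (d + 1) ℝ} {E : ℝ} (hE : 0 ≤ E) {c : Site (d + 1)}
    (hT : ∀ κ u, |T κ u| ≤ E * Real.exp (-(κ₀ * supNorm (quo N u - c)))) (κ : Fin (d + 1)) (u : Site (d + 1)) : |T κ u| ≤ E :=
  abs_le_of_env (L := N) hκ hE (hT κ) u

/-- [folklore] A 1-form under an envelope has summable components (`N ≥ 1`, `κ₀ > 0`). -/
theorem summable_of_env₁ (hN : 1 ≤ N) (hκ : 0 < κ₀) {T : Form1 (d + 1) ℝ} {E : ℝ} {c : Site (d + 1)}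
    (hT : ∀ κ u, |T κ u| ≤ E * Real.exp (-(κ₀ * supNorm (quo N u - c)))) (κ : Fin (d + 1)) : Summable (T κ) :=
  summable_of_env hN hκ (hT κ)

/-- [folklore] The ENV3 quantity is nonnegative. -/
theorem env3_nonneg (hκ : 0 < κ₀) (c₀ c₁ c₃ : Site (d + 1)) :
    0 ≤ (N : ℝ) ^ (d + 1) * Zl (d + 1) (κ₀ / (4 * ((d : ℝ) + 1))) * Real.exp (-(κ₀ / 12) * (supNorm (c₁ - c₀) + supNorm (c₃ - c₀))) := by
  have : 0 ≤ Zl (d + 1) (κ₀ / (4 * ((d : ℝ) + 1))) := Zl_nonneg (by positivity)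
  positivity

/-! ## §2 The LEFT-type cell: both partners dressed -/

section CellL

variable {ψ lam₁ lam₃ : Form0 (d + 1) ℝ} {T₁ T₃ B₁ B₃ φ₁ φ₃ : Form1 (d + 1) ℝ} {c₀ c₁ c₃ : Site (d + 1)}
  {Eψ EB₁ EB₃ τ₁ τ₃ Bg₁ Bg₃ : ℝ}

/-- NOT IN PRINT; OUR BOOKKEEPING.  **THE LEFT-TYPE CELL REDUCED TO ITS PIECES** (both partners dressed; see the module docstring for the shape):
`|cell| ≤ ½(d+1)·Eψ·e^{κ₀}·(EB₁·τ₃ + EB₃·τ₁)·ENV3(c₀; c₁, c₃) + ½Σ_κ |tip pairing_κ(𝒬ᵀφ₃; ψ; λ₁)| + ½Σ_b |mid pairing_b(𝒬ᵀφ₁; ψ; λ₃)|`. -/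
theorem abs_cellL_le_pieces (hN : 1 ≤ N) (hκ : 0 < κ₀) (hEψ : 0 ≤ Eψ) (hEB₁ : 0 ≤ EB₁) (hEB₃ : 0 ≤ EB₃) (hτ₁ : 0 ≤ τ₁) (hτ₃ : 0 ≤ τ₃)
    (hψ : ∀ x, |ψ x| ≤ Eψ * Real.exp (-(κ₀ * supNorm (quo N x - c₀))))
    (hT₁ : ∀ κ u, T₁ κ u = B₁ κ u + (lam₁ (u + unitVec κ) - lam₁ u)) (hT₃ : ∀ b z, T₃ b z = B₃ b z + (lam₃ (z + unitVec b) - lam₃ z))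
    (hB₁ : ∀ κ u, |B₁ κ u| ≤ EB₁ * Real.exp (-(κ₀ * supNorm (quo N u - c₁))))
    (hB₃ : ∀ b z, |B₃ b z| ≤ EB₃ * Real.exp (-(κ₀ * supNorm (quo N z - c₃))))
    (hg₁ : ∀ x, |lam₁ x| ≤ Bg₁) (hg₃ : ∀ x, |lam₃ x| ≤ Bg₃) (hT₃s : ∀ b, Summable (T₃ b))
    (hM₁ : curvAdj (curv T₁) = contourSumAdj N φ₁) (hM₃ : curvAdj (curv T₃) = contourSumAdj N φ₃)
    (ht₁ : ∀ b z, |contourSumAdj N φ₁ b z| ≤ τ₁ * Real.exp (-(κ₀ * supNorm (quo N z - c₁))))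
    (ht₃ : ∀ κ u, |contourSumAdj N φ₃ κ u| ≤ τ₃ * Real.exp (-(κ₀ * supNorm (quo N u - c₃)))) :
    |∑' z, ∑ b, T₃ b z *
        ∑' u, ∑ κ, T₁ κ u * ((1 / 2 : ℝ) * (ψ (u + unitVec κ) - (ψ z + ψ (z + unitVec b)) / 2) * curvAdj (curv (delta1 κ u)) b z)|
      ≤ (1 / 2 : ℝ) * (((d : ℝ) + 1) * (Eψ * Real.exp κ₀) * (EB₁ * τ₃ + EB₃ * τ₁)) *
          ((N : ℝ) ^ (d + 1) * Zl (d + 1) (κ₀ / (4 * ((d : ℝ) + 1))) * Real.exp (-(κ₀ / 12) * (supNorm (c₁ - c₀) + supNorm (c₃ - c₀))))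
        + (1 / 2 : ℝ) * ∑ κ, |∑' u, contourSumAdj N φ₃ κ u * ψ (u + AffineAveraging.unitVec κ) *
            (lam₁ (u + AffineAveraging.unitVec κ) - lam₁ u)|
        + (1 / 2 : ℝ) * ∑ b, |∑' z, contourSumAdj N φ₁ b z * ((ψ z + ψ (z + AffineAveraging.unitVec b)) / 2) *
            (lam₃ (z + AffineAveraging.unitVec b) - lam₃ z)| := by
  -- sup bounds and summability from the envelopes
  have hψb : ∀ x, |ψ x| ≤ Eψ := fun x => abs_le_of_env (L := N) hκ.le hEψ hψ x
  have hB₁b : ∀ κ u, |B₁ κ u| ≤ EB₁ := abs_le_of_env₁ hκ.le hEB₁ hB₁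
  have hB₃b : ∀ b z, |B₃ b z| ≤ EB₃ := abs_le_of_env₁ hκ.le hEB₃ hB₃
  have hT₁b : ∀ κ u, |T₁ κ u| ≤ EB₁ + 2 * Bg₁ := by
    intro κ u
    rw [hT₁]
    have h1 := hB₁b κ u; have h2 := hg₁ (u + unitVec κ); have h3 := hg₁ u
    have h4 := abs_add_le (B₁ κ u) (lam₁ (u + unitVec κ) - lam₁ u); have h5 := abs_sub (lam₁ (u + unitVec κ)) (lam₁ u)
    linarith
  have hM₁b : ∀ b z, |curvAdj (curv T₁) b z| ≤ τ₁ := fun b z => by rw [hM₁]; exact abs_le_of_env₁ hκ.le hτ₁ ht₁ b z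
  have ht₁s : ∀ b, Summable (contourSumAdj N φ₁ b) := summable_of_env₁ hN hκ ht₁
  have ht₃s : ∀ κ, Summable (contourSumAdj N φ₃ κ) := summable_of_env₁ hN hκ ht₃
  -- leaf-02's cell identity, then the dressed partners opened and split
  rw [cell_eq' hT₃s hψb hT₁b hM₁b, hM₁, hM₃]
  have eA : (∑' u, ∑ κ, ψ (u + unitVec κ) * T₁ κ u * contourSumAdj N φ₃ κ u)
      = ∑' u, ∑ κ, ψ (u + unitVec κ) * (B₁ κ u + (lam₁ (u + unitVec κ) - lam₁ u)) * contourSumAdj N φ₃ κ u :=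
    tsum_congr fun u => Finset.sum_congr rfl fun κ _ => by rw [hT₁]
  have eB : (∑' z, ∑ b, (ψ z + ψ (z + unitVec b)) / 2 * T₃ b z * contourSumAdj N φ₁ b z)
      = ∑' z, ∑ b, (ψ z + ψ (z + unitVec b)) / 2 * (B₃ b z + (lam₃ (z + unitVec b) - lam₃ z)) * contourSumAdj N φ₁ b z :=
    tsum_congr fun z => Finset.sum_congr rfl fun b _ => by rw [hT₃]
  rw [eA, eB, split_tip ht₃s hψb hB₁b hg₁, split_mid ht₁s hψb hB₃b hg₃]
  -- the two undressed three-envelope pieces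
  obtain ⟨-, hA1⟩ := abs_tsum_weight_mul_mul_le (L := N) (d := d) hN hκ (w := fun κ u => ψ (u + unitVec κ)) (T := B₁)
    (M := contourSumAdj N φ₃) (z₀ := c₀) (z₁ := c₁) (z₃ := c₃) (by positivity) hEB₁ hτ₃
    (fun κ u => abs_tip_weight_le hN hκ.le hEψ hψ κ u) hB₁ ht₃
  obtain ⟨-, hB1⟩ := abs_tsum_weight_mul_mul_le (L := N) (d := d) hN hκ (w := fun b z => (ψ z + ψ (z + unitVec b)) / 2) (T := B₃)
    (M := contourSumAdj N φ₁) (z₀ := c₀) (z₁ := c₃) (z₃ := c₁) (by positivity) hEB₃ hτ₁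
    (fun b z => abs_mid_weight_le hN hκ.le hEψ hψ b z) hB₃ ht₁
  rw [add_comm (supNorm (c₃ - c₀)) (supNorm (c₁ - c₀))] at hB1
  -- spell the pairing pieces with the affine `unitVec`
  simp only [← affine_unitVec_eq] at *
  set ENV := (N : ℝ) ^ (d + 1) * Zl (d + 1) (κ₀ / (4 * ((d : ℝ) + 1))) * Real.exp (-(κ₀ / 12) * (supNorm (c₁ - c₀) + supNorm (c₃ - c₀))) with hENV
  set A1 := ∑' u, ∑ κ, ψ (u + AffineAveraging.unitVec κ) * B₁ κ u * contourSumAdj N φ₃ κ u with hA1def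
  set A2 := ∑ κ, ∑' u, contourSumAdj N φ₃ κ u * ψ (u + AffineAveraging.unitVec κ) *
    (lam₁ (u + AffineAveraging.unitVec κ) - lam₁ u) with hA2def
  set B1 := ∑' z, ∑ b, (ψ z + ψ (z + AffineAveraging.unitVec b)) / 2 * B₃ b z * contourSumAdj N φ₁ b z with hB1def
  set B2 := ∑ b, ∑' z, contourSumAdj N φ₁ b z * ((ψ z + ψ (z + AffineAveraging.unitVec b)) / 2) *
    (lam₃ (z + AffineAveraging.unitVec b) - lam₃ z) with hB2def
  have hA2 : |A2| ≤ ∑ κ, |∑' u, contourSumAdj N φ₃ κ u * ψ (u + AffineAveraging.unitVec κ) *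
      (lam₁ (u + AffineAveraging.unitVec κ) - lam₁ u)| := Finset.abs_sum_le_sum_abs _ _
  have hB2 : |B2| ≤ ∑ b, |∑' z, contourSumAdj N φ₁ b z * ((ψ z + ψ (z + AffineAveraging.unitVec b)) / 2) *
      (lam₃ (z + AffineAveraging.unitVec b) - lam₃ z)| := Finset.abs_sum_le_sum_abs _ _
  have habs : |(1 / 2 : ℝ) * (A1 + A2) - (1 / 2 : ℝ) * (B1 + B2)| ≤ (1 / 2 : ℝ) * (|A1| + |A2|) + (1 / 2 : ℝ) * (|B1| + |B2|) := by
    have h1 := abs_sub ((1 / 2 : ℝ) * (A1 + A2)) ((1 / 2 : ℝ) * (B1 + B2))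
    have h2 := abs_add_le A1 A2; have h3 := abs_add_le B1 B2
    rw [abs_mul, abs_mul, abs_of_pos (by norm_num : (0 : ℝ) < 1 / 2)] at h1
    linarith
  refine habs.trans ?_
  have hsum : (1 / 2 : ℝ) * (|A1| + |A2|) + (1 / 2 : ℝ) * (|B1| + |B2|)
      ≤ (1 / 2 : ℝ) * ((((d : ℝ) + 1) * (Eψ * Real.exp κ₀) * EB₁ * τ₃ * ENV) + |A2|)
        + (1 / 2 : ℝ) * ((((d : ℝ) + 1) * (Eψ * Real.exp κ₀) * EB₃ * τ₁ * ENV) + |B2|) := by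
    have := hA1; have := hB1; nlinarith [abs_nonneg A2, abs_nonneg B2]
  refine hsum.trans ?_
  nlinarith [hA2, hB2, env3_nonneg (N := N) (d := d) hκ c₀ c₁ c₃, abs_nonneg A2, abs_nonneg B2]

end CellL

/-! ## §3 The RIGHT-type cell: the outer partner undressed, the inner one dressed -/

section CellR

variable {ψ lam₁ : Form0 (d + 1) ℝ} {T₁ B₁ B₃ φ₁ φ₃ : Form1 (d + 1) ℝ} {c₀ c₁ c₃ : Site (d + 1)} {Eψ EB₁ EB₃ τ₁ τ₃ Bg₁ : ℝ}

/-- NOT IN PRINT; OUR BOOKKEEPING.  **THE RIGHT-TYPE CELL REDUCED TO ITS PIECES** (outer partner `B₃` UNDRESSED about `c₃` with `d*dB₃ = 𝒬ᵀ_Nφ₃`; inner partner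
`T₁ = B₁ + dλ₁` dressed about `c₁` in the TIP position):
`|cell| ≤ ½(d+1)·Eψ·e^{κ₀}·(EB₁·τ₃ + EB₃·τ₁)·ENV3(c₀; c₁, c₃) + ½Σ_κ |tip pairing_κ(𝒬ᵀφ₃; ψ; λ₁)|`. -/
theorem abs_cellR_le_pieces (hN : 1 ≤ N) (hκ : 0 < κ₀) (hEψ : 0 ≤ Eψ) (hEB₁ : 0 ≤ EB₁) (hEB₃ : 0 ≤ EB₃) (hτ₁ : 0 ≤ τ₁) (hτ₃ : 0 ≤ τ₃)
    (hψ : ∀ x, |ψ x| ≤ Eψ * Real.exp (-(κ₀ * supNorm (quo N x - c₀))))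
    (hT₁ : ∀ κ u, T₁ κ u = B₁ κ u + (lam₁ (u + unitVec κ) - lam₁ u))
    (hB₁ : ∀ κ u, |B₁ κ u| ≤ EB₁ * Real.exp (-(κ₀ * supNorm (quo N u - c₁))))
    (hB₃ : ∀ b z, |B₃ b z| ≤ EB₃ * Real.exp (-(κ₀ * supNorm (quo N z - c₃))))
    (hg₁ : ∀ x, |lam₁ x| ≤ Bg₁)
    (hM₁ : curvAdj (curv T₁) = contourSumAdj N φ₁) (hM₃ : curvAdj (curv B₃) = contourSumAdj N φ₃)
    (ht₁ : ∀ b z, |contourSumAdj N φ₁ b z| ≤ τ₁ * Real.exp (-(κ₀ * supNorm (quo N z - c₁))))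
    (ht₃ : ∀ κ u, |contourSumAdj N φ₃ κ u| ≤ τ₃ * Real.exp (-(κ₀ * supNorm (quo N u - c₃)))) :
    |∑' z, ∑ b, B₃ b z *
        ∑' u, ∑ κ, T₁ κ u * ((1 / 2 : ℝ) * (ψ (u + unitVec κ) - (ψ z + ψ (z + unitVec b)) / 2) * curvAdj (curv (delta1 κ u)) b z)|
      ≤ (1 / 2 : ℝ) * (((d : ℝ) + 1) * (Eψ * Real.exp κ₀) * (EB₁ * τ₃ + EB₃ * τ₁)) *
          ((N : ℝ) ^ (d + 1) * Zl (d + 1) (κ₀ / (4 * ((d : ℝ) + 1))) * Real.exp (-(κ₀ / 12) * (supNorm (c₁ - c₀) + supNorm (c₃ - c₀))))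
        + (1 / 2 : ℝ) * ∑ κ, |∑' u, contourSumAdj N φ₃ κ u * ψ (u + AffineAveraging.unitVec κ) *
            (lam₁ (u + AffineAveraging.unitVec κ) - lam₁ u)| := by
  have hψb : ∀ x, |ψ x| ≤ Eψ := fun x => abs_le_of_env (L := N) hκ.le hEψ hψ x
  have hB₁b : ∀ κ u, |B₁ κ u| ≤ EB₁ := abs_le_of_env₁ hκ.le hEB₁ hB₁
  have hT₁b : ∀ κ u, |T₁ κ u| ≤ EB₁ + 2 * Bg₁ := by
    intro κ u
    rw [hT₁]
    have h1 := hB₁b κ u; have h2 := hg₁ (u + unitVec κ); have h3 := hg₁ u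
    have h4 := abs_add_le (B₁ κ u) (lam₁ (u + unitVec κ) - lam₁ u); have h5 := abs_sub (lam₁ (u + unitVec κ)) (lam₁ u)
    linarith
  have hM₁b : ∀ b z, |curvAdj (curv T₁) b z| ≤ τ₁ := fun b z => by rw [hM₁]; exact abs_le_of_env₁ hκ.le hτ₁ ht₁ b z
  have hB₃s : ∀ b, Summable (B₃ b) := summable_of_env₁ hN hκ hB₃
  have ht₃s : ∀ κ, Summable (contourSumAdj N φ₃ κ) := summable_of_env₁ hN hκ ht₃
  rw [cell_eq' hB₃s hψb hT₁b hM₁b, hM₁, hM₃]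
  have eA : (∑' u, ∑ κ, ψ (u + unitVec κ) * T₁ κ u * contourSumAdj N φ₃ κ u)
      = ∑' u, ∑ κ, ψ (u + unitVec κ) * (B₁ κ u + (lam₁ (u + unitVec κ) - lam₁ u)) * contourSumAdj N φ₃ κ u :=
    tsum_congr fun u => Finset.sum_congr rfl fun κ _ => by rw [hT₁]
  rw [eA, split_tip ht₃s hψb hB₁b hg₁]
  obtain ⟨-, hA1⟩ := abs_tsum_weight_mul_mul_le (L := N) (d := d) hN hκ (w := fun κ u => ψ (u + unitVec κ)) (T := B₁)
    (M := contourSumAdj N φ₃) (z₀ := c₀) (z₁ := c₁) (z₃ := c₃) (by positivity) hEB₁ hτ₃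
    (fun κ u => abs_tip_weight_le hN hκ.le hEψ hψ κ u) hB₁ ht₃
  obtain ⟨-, hB1⟩ := abs_tsum_weight_mul_mul_le (L := N) (d := d) hN hκ (w := fun b z => (ψ z + ψ (z + unitVec b)) / 2) (T := B₃)
    (M := contourSumAdj N φ₁) (z₀ := c₀) (z₁ := c₃) (z₃ := c₁) (by positivity) hEB₃ hτ₁
    (fun b z => abs_mid_weight_le hN hκ.le hEψ hψ b z) hB₃ ht₁
  rw [add_comm (supNorm (c₃ - c₀)) (supNorm (c₁ - c₀))] at hB1
  simp only [← affine_unitVec_eq] at *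
  set ENV := (N : ℝ) ^ (d + 1) * Zl (d + 1) (κ₀ / (4 * ((d : ℝ) + 1))) * Real.exp (-(κ₀ / 12) * (supNorm (c₁ - c₀) + supNorm (c₃ - c₀))) with hENV
  set A1 := ∑' u, ∑ κ, ψ (u + AffineAveraging.unitVec κ) * B₁ κ u * contourSumAdj N φ₃ κ u with hA1def
  set A2 := ∑ κ, ∑' u, contourSumAdj N φ₃ κ u * ψ (u + AffineAveraging.unitVec κ) *
    (lam₁ (u + AffineAveraging.unitVec κ) - lam₁ u) with hA2def
  set B1 := ∑' z, ∑ b, (ψ z + ψ (z + AffineAveraging.unitVec b)) / 2 * B₃ b z * contourSumAdj N φ₁ b z with hB1def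
  have hA2 : |A2| ≤ ∑ κ, |∑' u, contourSumAdj N φ₃ κ u * ψ (u + AffineAveraging.unitVec κ) *
      (lam₁ (u + AffineAveraging.unitVec κ) - lam₁ u)| := Finset.abs_sum_le_sum_abs _ _
  have habs : |(1 / 2 : ℝ) * (A1 + A2) - (1 / 2 : ℝ) * B1| ≤ (1 / 2 : ℝ) * (|A1| + |A2|) + (1 / 2 : ℝ) * |B1| := by
    have h1 := abs_sub ((1 / 2 : ℝ) * (A1 + A2)) ((1 / 2 : ℝ) * B1)
    have h2 := abs_add_le A1 A2
    rw [abs_mul, abs_mul, abs_of_pos (by norm_num : (0 : ℝ) < 1 / 2)] at h1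
    linarith
  refine habs.trans ?_
  nlinarith [hA1, hB1, hA2, env3_nonneg (N := N) (d := d) hκ c₀ c₁ c₃, abs_nonneg A2]

end CellR

end Summit.QuantumFields.BalabanUV.Beta.GAN24.ContactCellReduction

end
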